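import Mathlib
import Literature.Probability.RandomPlanarGeometry.HexSAW
import Literature.Probability.LatticeModels.AnchoredClusterExpansion
import Literature.Probability.LatticeModels.PolymerPressureAnalytic
import Summits.CriticalPhenomena.SAWScalingLimit.Theses.SAWMassiveIsingTilt
import Summits.CriticalPhenomena.SAWScalingLimit.Theorems.SAWMassiveIsingTiltDefs
import Summits.CriticalPhenomena.SAWScalingLimit.Theorems.SAWMassiveIsingTiltTiltLawBasic
import Summits.CriticalPhenomena.SAWScalingLimit.Theorems.SAWMassiveIsingTiltCriticalCurveContinuityDifferentiableZloop
import Summits.CriticalPhenomena.SAWScalingLimit.Theorems.SAWMassiveIsingTiltCriticalCurveContinuityZloopPolymerGas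
import Summits.CriticalPhenomena.SAWScalingLimit.Theorems.SAWMassiveIsingTiltCriticalCurveContinuityIsSmallActivityLoopActivity

/-!
# The walk-dependent part of the bath score is `O(ℓ(γ))` in the Kotecký–Preiss regime

Route `SAWMassiveIsingTilt` of `CriticalPhenomena/SAWScalingLimit`; lead prover (c3) of the line
`registered` of the crux `CriticalCurveContinuity` (stmt-CriticalPhenomena-7686), cycle 3, sub-goal
Z6 `zloop_score_sub_le_smallFugacity`.

The `y`-score of the registered stub `stub_scoreDecoupling` is
`s_y(γ) = ℓ(γ)·xc'(y)/xc(y) + ∂_y log Zloop(Ω_δ∖γ; y)`. Its bath term splits as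
`∂_y log Zloop(Ω_δ; y)` (independent of the walk — it drops out of every covariance) minus the
`y`-derivative of the CARVING COST `F(γ; y) = log Zloop(Ω_δ; y) − log Zloop(Ω_δ∖γ; y)`. We prove:
there are `y₁ > 0` and `K` such that for all `y ∈ [0, y₁]`, all Dobrushin domains, meshes `δ > 0`
and hexagonal SAWs `γ`,

`|∂_y log Zloop(Ω_δ∖γ; y) − ∂_y log Zloop(Ω_δ; y)| ≤ K·ℓ(γ)`

(`zloop_score_sub_le_smallFugacity`; `K = 2/y₀`, `y₁ = y₀/4` with `y₀` the smallness radius of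
`isSmallActivity_loopActivity`). So in the Kotecký–Preiss regime the walk-dependent part of the
bath score is of the SAME ORDER as the fugacity-renormalisation term `ℓ(γ)·xc'/xc` it is compared
with — the quantitative form of "the y-score is a fugacity renormalisation plus a finite-range
remainder" at the level of sizes (the remainder's locality is `zloop_restrictionDefect_le_smallFugacity`).

Proof. With the landed `zloop_eq_polymerPartitionFunction` (p154156), for complex `z` the carving
cost is `g(z) = log Ξ(𝒫(W); ρ_z) − log Ξ(𝒫(W) ∖ D_γ; ρ_z)` (`D_γ` = polymers meeting `γ`), which by
KP (2) is the sum of the truncated functionals of the clusters meeting `γ` — UNCONDITIONALLY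
(`polymerLogZ_sub_sdiff_eq_sum`) — hence, in the smallness region `|z| ≤ y₀`
(`isSmallActivity_loopActivity`, p154336), bounded in norm by `Σ_{v ∈ γ} Σ_{C ∋ v} |Φ^T(C)| ≤ ℓ(γ)`
(KP (4) at one-site polymers, `IsSmallActivity.sum_norm_truncatedWeight_anchored_le`). `g` is
holomorphic on `|z| < y₀` (`differentiableOn_polymerLogZ_param`: the activities are polynomials and
the ray partition functions do not vanish), so the Cauchy estimate on the circle of radius `y₀/2`
about `y ∈ [0, y₀/4]` gives `|g'(y)| ≤ 2ℓ(γ)/y₀`; on the real axis `g` is the real carving cost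
(`polymerLogZ_eq_log_of_real`), whose derivative is the difference of the two logarithmic derivatives
of `Zloop` (`differentiable_zloop`, p147827).
-/

noncomputable section

open Finset Filter Topology Metric
open Literature.Probability Literature.Probability.LatticeModels
  Literature.Probability.RandomPlanarGeometry
open Summit.CriticalPhenomena.SAWScalingLimit.Theses.SAWMassiveIsingTilt
open scoped Classical

namespace Summit.CriticalPhenomena.SAWScalingLimit.Theorems.SAWMassiveIsingTilt

/-! ### Generic cluster-expansion bookkeeping -/

/-- Smallness is inherited by activities of smaller norm (e.g. along the ray `u • ρ`, `u ∈ [0,1]`). -/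
theorem isSmallActivity_of_norm_le {α : Type*} [DecidableEq α] {ρ ρ' : Finset α → ℂ} {δ : ℝ}
    (h : IsSmallActivity ρ δ) (h0 : ρ' ∅ = 0) (hle : ∀ A, ‖ρ' A‖ ≤ ‖ρ A‖) : IsSmallActivity ρ' δ := by
  refine ⟨h0, h.delta_pos, fun x 𝒜 h𝒜 => le_trans (Finset.sum_le_sum fun A _ => ?_) (h.sum_le_one x 𝒜 h𝒜)⟩
  exact mul_le_mul_of_nonneg_right (hle A) (Real.exp_nonneg _)

/-- **KP (2), anchored and unconditional**: `log Ξ(Λ) − log Ξ(Λ ∖ D)` is the sum of the truncated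
functionals of the families inside `Λ` meeting `D` (both logarithms are the Kotecký–Preiss branches;
pure Möbius bookkeeping, no smallness needed). -/
theorem polymerLogZ_sub_sdiff_eq_sum {P : Type*} [DecidableEq P] (inc : P → P → Prop) [DecidableRel inc]
    (w : P → ℂ) (Λ D : Finset P) :
    polymerLogZ inc w Λ - polymerLogZ inc w (Λ \ D) =
      ∑ C ∈ Λ.powerset with (C ∩ D).Nonempty, truncatedWeight inc w C := by
  rw [polymerLogZ_eq_sum_truncatedWeight, polymerLogZ_eq_sum_truncatedWeight,
    ← Finset.sum_filter_add_sum_filter_not Λ.powerset (fun C => (C ∩ D).Nonempty)]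
  have hset : Λ.powerset.filter (fun C => ¬ (C ∩ D).Nonempty) = (Λ \ D).powerset := by
    ext C
    simp only [Finset.mem_filter, Finset.mem_powerset, Finset.not_nonempty_iff_eq_empty,
      Finset.subset_sdiff, Finset.disjoint_iff_inter_eq_empty]
  rw [hset]
  ring

/-- Domination of the sum over the families meeting `D` by the sums anchored at the vertices of
`T`, when every polymer of `D` contains a vertex of `T`. -/
theorem sum_filter_inter_nonempty_le_sum_anchored {𝒞 : Finset (Finset (Finset HexVertex))}
    {D : Finset (Finset HexVertex)} (T : Finset HexVertex) (hD : ∀ A ∈ D, ∃ v ∈ A, v ∈ T)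
    (g : Finset (Finset HexVertex) → ℝ) (hg : ∀ C, 0 ≤ g C) :
    ∑ C ∈ 𝒞 with (C ∩ D).Nonempty, g C ≤ ∑ v ∈ T, ∑ C ∈ 𝒞 with v ∈ clusterSupp C, g C := by
  calc ∑ C ∈ 𝒞 with (C ∩ D).Nonempty, g C
      ≤ ∑ C ∈ 𝒞 with (C ∩ D).Nonempty, ∑ v ∈ T, (if v ∈ clusterSupp C then g C else 0) := by
        refine Finset.sum_le_sum fun C hC => ?_
        obtain ⟨A, hA⟩ := (Finset.mem_filter.1 hC).2
        obtain ⟨hAC, hAD⟩ := Finset.mem_inter.1 hA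
        obtain ⟨v, hvA, hvT⟩ := hD A hAD
        have h := Finset.single_le_sum (s := T) (f := fun v => if v ∈ clusterSupp C then g C else 0)
          (fun v _ => ite_nonneg (hg C) le_rfl) hvT
        simpa [mem_clusterSupp.2 ⟨A, hAC, hvA⟩] using h
    _ ≤ ∑ C ∈ 𝒞, ∑ v ∈ T, (if v ∈ clusterSupp C then g C else 0) :=
        Finset.sum_le_sum_of_subset_of_nonneg (Finset.filter_subset _ _) fun C _ _ =>
          Finset.sum_nonneg fun _ _ => ite_nonneg (hg C) le_rfl
    _ = ∑ v ∈ T, ∑ C ∈ 𝒞 with v ∈ clusterSupp C, g C := by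
        rw [Finset.sum_comm]
        refine Finset.sum_congr rfl fun v _ => ?_
        rw [Finset.sum_filter]

/-- The vertices of `E(Ω_δ)` "in `Set.univ`" are all of them (implicit decidability instance). -/
theorem filter_mem_univ_eq (W : Finset HexVertex)
    {_i : DecidablePred fun v : HexVertex => v ∈ (Set.univ : Set HexVertex)} :
    (W.filter fun v => v ∈ (Set.univ : Set HexVertex)) = W := by
  ext v
  simp

/-- Carving the walk's vertices out of the volume removes exactly the polymers meeting the walk
(implicit decidability instances). -/
theorem powerset_filter_notMem_eq (W : Finset HexVertex) (L : List HexVertex)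
    {_i₁ : DecidablePred fun v : HexVertex => v ∈ {u : HexVertex | u ∉ L}}
    {_i₂ : DecidablePred fun A : Finset HexVertex => ∃ v ∈ A, v ∈ L} :
    (W.filter fun v => v ∈ {u : HexVertex | u ∉ L}).powerset =
      W.powerset \ W.powerset.filter fun A => ∃ v ∈ A, v ∈ L := by
  ext A
  simp only [Finset.mem_powerset, Finset.mem_sdiff, Finset.mem_filter, Finset.subset_iff,
    Set.mem_setOf_eq, not_and, not_exists]
  constructor
  · intro h
    exact ⟨fun a ha => (h ha).1, fun _ a ha hL => (h ha).2 hL⟩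
  · rintro ⟨h1, h2⟩ a ha
    exact ⟨h1 ha, h2 h1 a ha⟩

/-! ### The theorem -/

/-- **Sub-goal Z6 of the line (cycle 3): in the Kotecký–Preiss regime the walk-dependent part of
the bath score is `O(ℓ(γ))`.** There are `y₁ > 0` and `K` such that for every `y ∈ [0, y₁]`, every
Dobrushin domain, mesh `δ > 0` and hexagonal SAW `γ` of `Ω_δ`,
`|∂_y log Zloop(Ω_δ∖γ; y) − ∂_y log Zloop(Ω_δ; y)| ≤ K·ℓ(γ)`. -/
theorem zloop_score_sub_le_smallFugacity : ∃ y₁ : ℝ, 0 < y₁ ∧ ∃ K : ℝ,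
    ∀ y ∈ Set.Icc (0 : ℝ) y₁, ∀ (D : DobrushinDomain) (δ : ℝ), 0 < δ →
      ∀ (a b : HexVertex) (γ : SAW.HexDomainSAW D.carrier δ a b),
        |deriv (fun t => Zloop (SAW.hexDomainGraph D.carrier δ) {v | v ∉ γ.walk.support} t) y /
            Zloop (SAW.hexDomainGraph D.carrier δ) {v | v ∉ γ.walk.support} y -
          deriv (fun t => Zloop (SAW.hexDomainGraph D.carrier δ) Set.univ t) y /
            Zloop (SAW.hexDomainGraph D.carrier δ) Set.univ y| ≤ K * γ.vertexCount := by
  obtain ⟨y₀, hy₀, hsmallAll⟩ := isSmallActivity_loopActivity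
  refine ⟨y₀ / 4, by positivity, 2 / y₀, fun y hy D δ hδ a b γ => ?_⟩
  have hΩ : Bornology.IsBounded D.carrier := D.isBounded
  have hδ0 : δ ≠ 0 := ne_of_gt hδ
  -- notation
  set H := SAW.hexDomainGraph D.carrier δ with hH
  set Sγ : Set HexVertex := {v | v ∉ γ.walk.support} with hSγ
  set EH : Finset (Sym2 HexVertex) := (finite_edgeSet_hexDomainGraph hΩ hδ0).toFinset with hEH
  set W : Finset HexVertex := EH.biUnion Sym2.toFinset with hW
  set ρ : ℂ → Finset HexVertex → ℂ := fun z A => ∑ E ∈ EH.powerset with (E.biUnion Sym2.toFinset = A ∧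
      A.Nonempty ∧ (∀ u : HexVertex, Even (E.filter (fun e => u ∈ e)).card) ∧
      ∀ u ∈ A, ∀ w ∈ A,
        (SimpleGraph.fromEdgeSet ((E : Finset (Sym2 HexVertex)) : Set (Sym2 HexVertex))).Reachable u w),
    z ^ E.card with hρ
  set Dγ : Finset (Finset HexVertex) := W.powerset.filter fun A => ∃ v ∈ A, v ∈ γ.walk.support with hDγ
  have hEHhex : ∀ e ∈ EH, e ∈ hexGraph.edgeSet := by
    intro e he
    rw [hEH, Set.Finite.mem_toFinset] at he
    exact SimpleGraph.edgeSet_mono (SAW.embDomainGraph_le hexGraph hexCenter D.carrier δ) he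
  -- smallness in the closed disc, also along rays
  have hsmall : ∀ z : ℂ, ‖z‖ ≤ y₀ → IsSmallActivity (ρ z) (1 / 2) := fun z hz => hsmallAll EH hEHhex z hz
  have hρ0 : ∀ z : ℂ, ρ z ∅ = 0 := fun z => by
    refine Finset.sum_eq_zero fun E hE => ?_
    exact absurd (Finset.mem_filter.1 hE).2.2.1 Finset.not_nonempty_empty
  have hray : ∀ z : ℂ, ‖z‖ ≤ y₀ → ∀ u ∈ Set.Icc (0 : ℝ) 1,
      IsSmallActivity (fun A => (u : ℂ) * ρ z A) (1 / 2) := by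
    intro z hz u hu
    refine isSmallActivity_of_norm_le (hsmall z hz) (by rw [hρ0 z, mul_zero]) fun A => ?_
    rw [norm_mul, Complex.norm_real, Real.norm_eq_abs, abs_of_nonneg hu.1]
    exact mul_le_of_le_one_left (norm_nonneg _) hu.2
  -- the complex carving cost and its cluster representation
  set g : ℂ → ℂ := fun z => polymerLogZ polyInc (ρ z) W.powerset -
    polymerLogZ polyInc (ρ z) (W.powerset \ Dγ) with hg
  have hgsum : ∀ z, g z = ∑ C ∈ W.powerset.powerset with (C ∩ Dγ).Nonempty, truncatedWeight polyInc (ρ z) C :=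
    fun z => polymerLogZ_sub_sdiff_eq_sum polyInc (ρ z) W.powerset Dγ
  have hℓ : (γ.walk.support.toFinset.card : ℝ) = γ.vertexCount := by
    rw [List.toFinset_card_of_nodup γ.isPath.support_nodup, SimpleGraph.Walk.length_support]
    rfl
  have hgbound : ∀ z : ℂ, ‖z‖ ≤ y₀ → ‖g z‖ ≤ γ.vertexCount := by
    intro z hz
    rw [hgsum z, ← hℓ]
    refine (norm_sum_le _ _).trans ?_
    refine (sum_filter_inter_nonempty_le_sum_anchored γ.walk.support.toFinset (fun A hA => ?_) _
      fun _ => norm_nonneg _).trans ?_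
    · obtain ⟨-, v, hvA, hvL⟩ := Finset.mem_filter.1 hA
      exact ⟨v, hvA, List.mem_toFinset.2 hvL⟩
    · calc ∑ v ∈ γ.walk.support.toFinset, ∑ C ∈ W.powerset.powerset with v ∈ clusterSupp C,
            ‖truncatedWeight polyInc (ρ z) C‖
          ≤ ∑ _v ∈ γ.walk.support.toFinset, (1 : ℝ) :=
            Finset.sum_le_sum fun v _ => (hsmall z hz).sum_norm_truncatedWeight_anchored_le v _
        _ = γ.walk.support.toFinset.card := by simp
  -- holomorphy of `g` on the open disc
  have hρdiff : ∀ A, Differentiable ℂ fun z => ρ z A := by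
    intro A
    simp only [hρ]
    exact Differentiable.fun_sum fun E _ => differentiable_pow E.card
  have hgdiff : DifferentiableOn ℂ g (ball (0 : ℂ) y₀) := by
    have hZ : ∀ (B : Finset (Finset HexVertex)), ∀ z ∈ ball (0 : ℂ) y₀, ∀ u ∈ Set.Icc (0 : ℝ) 1,
        polymerPartitionFunction polyInc (fun A => (u : ℂ) * ρ z A) B ≠ 0 := by
      intro B z hz u hu
      exact (hray z (le_of_lt (mem_ball_zero_iff.1 hz)) u hu).polymerPartitionFunction_ne_zero B
    exact (differentiableOn_polymerLogZ_param (inc := polyInc) W.powerset isOpen_ball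
        (fun A _ => (hρdiff A).differentiableOn) (hZ _)).sub
      (differentiableOn_polymerLogZ_param (inc := polyInc) (W.powerset \ Dγ) isOpen_ball
        (fun A _ => (hρdiff A).differentiableOn) (hZ _))
  -- Cauchy estimate at `y`
  have hyabs : ‖(y : ℂ)‖ ≤ y₀ / 4 := by
    rw [Complex.norm_real, Real.norm_eq_abs, abs_of_nonneg hy.1]; exact hy.2
  have hclosed : closedBall (y : ℂ) (y₀ / 2) ⊆ ball (0 : ℂ) y₀ := by
    intro z hz
    rw [mem_closedBall] at hz
    rw [mem_ball_zero_iff]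
    calc ‖z‖ = ‖(z - y) + y‖ := by ring_nf
      _ ≤ ‖z - (y : ℂ)‖ + ‖(y : ℂ)‖ := norm_add_le _ _
      _ ≤ y₀ / 2 + y₀ / 4 := add_le_add (by rwa [← dist_eq_norm]) hyabs
      _ < y₀ := by linarith
  have hderiv : ‖deriv g y‖ ≤ γ.vertexCount / (y₀ / 2) := by
    refine Complex.norm_deriv_le_of_forall_mem_sphere_norm_le (by positivity)
      (hgdiff.diffContOnCl_ball hclosed) fun z hz => hgbound z ?_
    have hz' : z ∈ closedBall (y : ℂ) (y₀ / 2) := sphere_subset_closedBall hz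
    exact (le_of_lt (mem_ball_zero_iff.1 (hclosed hz')))
  -- on the real axis `g` is the real carving cost
  have hZ : ∀ (t : ℝ) (S' : Set HexVertex), ((Zloop H S' t : ℝ) : ℂ) =
      polymerPartitionFunction polyInc (ρ t) (W.filter fun v => v ∈ S').powerset :=
    fun t S' => zloop_eq_polymerPartitionFunction hΩ hδ0 S' t
  have hreal : ∀ t : ℝ, |t| < y₀ →
      g t = ((Real.log (Zloop H Set.univ t) - Real.log (Zloop H Sγ t) : ℝ) : ℂ) := by
    intro t ht
    have htn : ‖(t : ℂ)‖ ≤ y₀ := by rw [Complex.norm_real, Real.norm_eq_abs]; exact ht.le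
    have him : ∀ A, (ρ t A).im = 0 := by
      intro A
      simp only [hρ]
      rw [Complex.im_sum]
      refine Finset.sum_eq_zero fun E _ => ?_
      rw [← Complex.ofReal_pow, Complex.ofReal_im]
    have hne : ∀ B : Finset (Finset HexVertex), ∀ u ∈ Set.Icc (0 : ℝ) 1,
        polymerPartitionFunction polyInc (fun A => (u : ℂ) * ρ t A) B ≠ 0 :=
      fun B u hu => (hray t htn u hu).polymerPartitionFunction_ne_zero B
    have h1 := (polymerLogZ_eq_log_of_real (inc := polyInc) him (hne W.powerset)).2
    have h2 := (polymerLogZ_eq_log_of_real (inc := polyInc) him (hne (W.powerset \ Dγ))).2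
    have hZ1 := hZ t Set.univ
    rw [filter_mem_univ_eq W] at hZ1
    have hZ2 := hZ t Sγ
    rw [hSγ, powerset_filter_notMem_eq W γ.walk.support] at hZ2
    simp only [hg]
    rw [h1, h2, ← hZ1, ← hZ2, Complex.ofReal_re, Complex.ofReal_re, Complex.ofReal_sub]
  -- transfer the complex derivative to the real carving cost
  have hHas : HasDerivAt g (deriv g y) y :=
    (hgdiff.differentiableAt (isOpen_ball.mem_nhds (hclosed (mem_closedBall_self (by positivity))))).hasDerivAt
  have hre := hHas.real_of_complex
  have hG : HasDerivAt (fun t : ℝ => Real.log (Zloop H Set.univ t) - Real.log (Zloop H Sγ t))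
      (deriv g y).re y := by
    refine hre.congr_of_eventuallyEq ?_
    have hnhds : ball y (y₀ / 2) ∈ 𝓝 y := ball_mem_nhds y (by positivity)
    filter_upwards [hnhds] with t ht
    have ht' : |t| < y₀ := by
      rw [mem_ball, Real.dist_eq] at ht
      have hy' : |y| ≤ y₀ / 4 := by rw [abs_of_nonneg hy.1]; exact hy.2
      calc |t| = |(t - y) + y| := by ring_nf
        _ ≤ |t - y| + |y| := abs_add_le _ _
        _ < y₀ / 2 + y₀ / 4 := add_lt_add_of_lt_of_le ht hy'
        _ ≤ y₀ := by linarith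
    rw [hreal t ht', Complex.ofReal_re]
  have hpos : ∀ S' : Set HexVertex, 0 < Zloop H S' y := fun S' =>
    lt_of_lt_of_le one_pos (one_le_zloop hΩ hδ0 hy.1 S')
  have hG' : HasDerivAt (fun t : ℝ => Real.log (Zloop H Set.univ t) - Real.log (Zloop H Sγ t))
      (deriv (fun t => Zloop H Set.univ t) y / Zloop H Set.univ y -
        deriv (fun t => Zloop H Sγ t) y / Zloop H Sγ y) y :=
    (((differentiable_zloop hΩ hδ0 Set.univ) y).hasDerivAt.log (hpos _).ne').sub
      (((differentiable_zloop hΩ hδ0 Sγ) y).hasDerivAt.log (hpos _).ne')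
  have heq := hG.unique hG'
  -- conclude
  have hK : γ.vertexCount / (y₀ / 2) = 2 / y₀ * γ.vertexCount := by
    field_simp
  calc |deriv (fun t => Zloop H Sγ t) y / Zloop H Sγ y -
        deriv (fun t => Zloop H Set.univ t) y / Zloop H Set.univ y|
      = |(deriv g y).re| := by rw [heq, ← abs_neg, neg_sub]
    _ ≤ ‖deriv g y‖ := Complex.abs_re_le_norm _
    _ ≤ γ.vertexCount / (y₀ / 2) := hderiv
    _ = 2 / y₀ * γ.vertexCount := hK

end Summit.CriticalPhenomena.SAWScalingLimit.Theorems.SAWMassiveIsingTilt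

end
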